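import Summits.BirchSwinnertonDyer.BirchSwinnertonDyer.Theorems.ByReductionTypeAtTwoAdditiveKatoTransportDescentNegTwoDoors
import HarnessLib

/-!
# Route ByReductionTypeAtTwo, crux C4″ `AdditivePotMultOverKAtTwo` (stmt-BirchSwinnertonDyer-22618; parent
# `AdditiveRankZeroAtTwo` 19098) — the (−2)-SPLIT-TWIST block doors keyed by the (−1) Literature CONSTRUCTION fact
# `Kato2004.exists_splitTwistDivisibilityInputsDescent_negOne_two`: the Decomposition and Model (over `ℚ(√−2)`) levels of the
# (−2) chain re-run (theorems only)

Cell `bsd-2adic`, seat `bsd-2adic-k4-w3` GEN 8 (explicit unit of director-bsd g16 (309)(7); R-B80 (1) of addL2x GEN 17).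
Companion of `…DescentNegTwoDoors.lean` (the (−2) base doors, every generator) and (−2)-twin of addL2x GEN 17's
`…AdditiveKatoTransportDescentModelDoors.lean`. FIELD FOR FIELD the (−2)-block theorems of
`…PrintExactAnyImageDecomposition.lean` / `…MemberDecomposition.lean` (GEN 4) and `…PrintExactAnyImageModelDoors.lean` §2
(GEN 5), with `hPE : KatoOddBranchInputsAtTwoNegOneSplitTwistPrintExactAnyImage` (resp. its R15-image `…NegTwo…AnyImage`)
replaced by `hDesc : Kato2004.exists_splitTwistDivisibilityInputsDescent_negOne_two` and the `𝐇¹_Γ`-pin binder `I` dropped (the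
base doors supply it). The base doors being stated for EVERY generator (`…DescentNegTwoDoors`: the normalisation `κ_cyc = 5`
is incompatible with `γ·√−2 = √−2` and is performed as a WLOG below the model door), every level here is the GEN 4–5 text
with ONE base-door name swapped. Every model / decomposition / functional-equation / isogeny ingredient is the cell's
existing KERNEL theorem, imported BY NAME (t42 GEN 21–24, k4-w3 GEN 2–6, addL2x GEN 15–17). The print and final levels are
in `…DescentNegTwoFinalDoors.lean`.

* §1 `lengthAt_selmerDual_le_of_splitTwistDescent_negTwo_of_decomposition_fe{,_of_isIsogenous}` — Decomposition door (key `γ`)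
  and its member form.
* §2 `lengthAt_selmerDual_le_of_splitTwistDescent_negTwo_fe_of_model` / `…Contra…` / `…_of_isIsogenous` — modulo the model `ΘS`
  over `F ∋ √−2`, for a generator FIXING `√−2`.

HONEST FRAMING (D-0036 / D-0054): theorems only — no definition, no named fact, no instance, no `sorry`; route-independent;
CONDITIONAL on `Kato2004.thm12_4`, `Greenberg1999_thm114_charIdeal_iota_invariant`,
`Greenberg1999.thm114_charIdeal_iota_invariant_splitMult_baseChange`, `Greenberg1999.thm15_isTorsion_multiplicative_rat`
(PRINT, BY NAME) and on the Literature construction fact `Kato2004.exists_splitTwistDivisibilityInputsDescent_negOne_two`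
(review-accepted p724228; debt of addL2x); types-the-object-of; closes none; nothing booked; BSD is not proved by any of this.
PARTITION: X5@2 additive potentially-multiplicative block, the (−2)-split sub-block (39 classes; 30 irreducible, 9 reducible)
× `p = 2`.

References: [Kato2004Asterisque] Thm. 12.4 (p. 221), Thm. 12.5 (3) with (12.5.1) (p. 222), Thm. 17.4 (1) (p. 273), §17.13
(pp. 279–280); [GreenbergLNM1716] §1 (p. 60), Thm. 1.5 (p. 61), Thm. 1.14 (p. 68), §4 (p. 107); [Greenberg1989] pp. 101–102;
[GreenbergVatsal2000] §2 (p. 28); [MazurTateTeitelbaum1986Invent] §I.13, §I.17; memos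
`run/shared/lean/pub/bsd-2adic/k4w3/gen8/VERDICT-22618-k4w3-GEN8.md`, `…/addL2x/VERDICT-19098-addL2x-GEN17.md`.
-/

set_option autoImplicit false
-- the summit's namespace `Summit.BirchSwinnertonDyer.BirchSwinnertonDyer` (Sub = Summit) trips `dupNamespace`
set_option linter.dupNamespace false

noncomputable section

open scoped Classical MatrixGroups ModularForm NumberField

open Field CongruenceSubgroup WeierstrassCurve IsDedekindDomain Literature.NumberTheory.EllipticCurves
  Literature.NumberTheory.EllipticCurves.ModularForms Literature.NumberTheory.EllipticCurves.IwasawaAlgebra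
  Literature.NumberTheory.EllipticCurves.Module Literature.NumberTheory.EllipticCurves.QuadraticLayer
  Literature.NumberTheory.EllipticCurves.Greenberg1999 Literature.NumberTheory.GaloisRepresentations
  Summit.BirchSwinnertonDyer.BirchSwinnertonDyer.Theorems

namespace Summit.BirchSwinnertonDyer.BirchSwinnertonDyer.Theorems.AddKatoTwo

/-! ## §1 The Decomposition door, key `γ`, and its member form -/

/-- **Decomposition door, (−2)-block, key `γ`, EVERY generator, keyed by the (−1) Literature fact, FE in the kernel.**
`ℓ_𝔮(X(W/ℚ_∞)) ≤ ℓ_𝔮(Λ/(L̃))` at EVERY height-one `𝔮 ∌ 2` for `W` globally minimal, additive with `W^{(−2)}` split multiplicative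
at `2`, from: `Kato2004.thm12_4`, the construction fact `Kato2004.exists_splitTwistDivisibilityInputsDescent_negOne_two`,
Greenberg Thm. 1.14 ×2 applied to a globally minimal model `W'` of the twist by `−2` over `ℚ` and over `F`, torsion finitely
generated dual data `D_F`, `D'`, the twist-decomposition in length form `hdec`, and `L̃ = 2^m·L⁻_2(f,1,ωχ₂) ≠ 0`. The body of
`lengthAt_selmerDual_le_of_oddBranchInputsNegTwoPrintExactAnyImage_of_decomposition_fe` with the key-`γ⁻¹` length-form door
replaced by `lengthAt_selmerDualContra_le_of_splitTwistDescent_negTwo_of_lengthAt_symm_fe`.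
[cite: Kato2004Asterisque, Thm. 12.4 (2) (p. 221), Thm. 12.5 (3) and (12.5.1) (p. 222), §17.3 (p. 273), §17.13 (pp. 279–280)]
[cite: GreenbergLNM1716, Thm. 1.14 (p. 68), §4 (p. 107)] [cite: Greenberg1989, pp. 101–102 (S^ι)]
[cite: MazurTateTeitelbaum1986Invent, §I.13, §I.17] -/
theorem lengthAt_selmerDual_le_of_splitTwistDescent_negTwo_of_decomposition_fe
    (hDesc : Kato2004.exists_splitTwistDivisibilityInputsDescent_negOne_two) (h12 : Kato2004.thm12_4)
    (h114 : Greenberg1999_thm114_charIdeal_iota_invariant)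
    (h114F : Greenberg1999.thm114_charIdeal_iota_invariant_splitMult_baseChange)
    (W : WeierstrassCurve ℚ) [W.IsElliptic] [W.IsGloballyMinimal] [ContinuousSMul ℤ_[2] (W.tateModule 2)]
    {N : ℕ} [NeZero N] (f : CuspForm (Gamma0 N) 2) (κ : ZpExtension ℚ 2) (γ : absoluteGaloisGroup ℚ)
    (hsp : (W.quadraticTwist (-2)).HasSplitMultiplicativeReductionAtPrime 2)
    (hκ : κ.IsCyclotomic) (hγ : κ.IsTopGenerator γ) (hγ' : IsCyclotomicVariable 2 γ)
    (hf : IsNewformOf (W.quadraticTwist (-2)) f) (D : W.SelmerDualData κ γ)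
    -- the twist over `ℚ` and over `F`, with the decomposition reading in length form
    (W' : WeierstrassCurve ℚ) [W'.IsElliptic] [W'.IsGloballyMinimal] (hmult' : W'.HasMultiplicativeReductionAtPrime 2)
    (F : Type) [Field F] [NumberField F]
    (hF : ∀ v : HeightOneSpectrum (𝓞 F), (2 : 𝓞 F) ∈ v.asIdeal → (W'.baseChange F).HasSplitMultiplicativeReductionAt v)
    (κF : ZpExtension F 2) (γF : Field.absoluteGaloisGroup F) (hκF : κF.IsCyclotomic) (hγF : κF.IsTopGenerator γF)
    (DF : (W'.baseChange F).SelmerDualData κF γF) [Module.Finite (IwasawaAlgebra 2) DF.X] (hDF : DF.IsTorsion)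
    (D' : W'.SelmerDualData κ γ) [Module.Finite (IwasawaAlgebra 2) D'.X] (hD' : D'.IsTorsion)
    (hdec : ∀ 𝔮 : PrimeSpectrum (IwasawaAlgebra 2), 𝔮.asIdeal.height = 1 →
      PowerSeries.C (2 : ℤ_[2]) ∉ 𝔮.asIdeal →
      lengthAt (IwasawaAlgebra 2) DF.X 𝔮 = lengthAt (IwasawaAlgebra 2) D'.X 𝔮 + lengthAt (IwasawaAlgebra 2) D.X 𝔮)
    -- the `2`-adic `L`-function side: the `χ₂`-twisted odd branch
    (Lt : IwasawaAlgebra 2) (m : ℕ)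
    (hLt : iwasawaToPowerSeries 2 Lt =
      PowerSeries.C ((2 : ℚ_[2]) ^ m) * padicLFunctionMinusBranchMultTwist f (1 : ℚ_[2]) 1 (-1))
    (hLt0 : Lt ≠ 0)
    (𝔮 : PrimeSpectrum (IwasawaAlgebra 2)) (h𝔮 : 𝔮.asIdeal.height = 1)
    (hp𝔮 : PowerSeries.C (2 : ℤ_[2]) ∉ 𝔮.asIdeal) :
    lengthAt (IwasawaAlgebra 2) D.X 𝔮 ≤
      lengthAt (IwasawaAlgebra 2) (IwasawaAlgebra 2 ⧸ Ideal.span {Lt}) 𝔮 := by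
  haveI : Fact (Nat.Prime 2) := ⟨Nat.prime_two⟩
  have hLtι : (Ideal.span {Lt}).map (invol 2).toRingHom = Ideal.span {Lt} :=
    MultOddBranchFE.map_invol_span_eq_of_eq_oddBranchMultTwist_two_of_split hsp hf hLt
  -- length symmetry of `D` at every height-one prime `∌ 2` (T20 (a) by name + `hdec`)
  have hsymD : ∀ 𝔭 : PrimeSpectrum (IwasawaAlgebra 2), 𝔭.asIdeal.height = 1 →
      PowerSeries.C ((2 : ℕ) : ℤ_[2]) ∉ 𝔭.asIdeal →
      lengthAt (IwasawaAlgebra 2) D.X 𝔭 =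
        lengthAt (IwasawaAlgebra 2) D.X (PrimeSpectrum.comap (invol 2).toRingHom 𝔭) := by
    intro 𝔭 h𝔭 hp𝔭
    have hp𝔭' : PowerSeries.C (2 : ℤ_[2]) ∉ 𝔭.asIdeal := by exact_mod_cast hp𝔭
    exact lengthAt_selmerDual_symm_of_decomposition h114 h114F W' hmult' F hF κF γF hκF hγF DF hDF κ γ hκ hγ D' hD' D
      hdec 𝔭 h𝔭 hp𝔭'
  -- the key-`γ⁻¹` twist of `D`
  obtain ⟨Dι, e, he, -⟩ := Kato2004.selmerDualData_exists_involTwist (mul_inv_cancel γ) D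
  -- the conjugate prime
  set 𝔮' := PrimeSpectrum.comap (invol 2).toRingHom 𝔮 with h𝔮'def
  have h𝔮' : 𝔮'.asIdeal.height = 1 := by rw [h𝔮'def, Kato2004.height_comap_invol]; exact h𝔮
  have hp𝔮' : PowerSeries.C (2 : ℤ_[2]) ∉ 𝔮'.asIdeal := by
    intro h
    apply hp𝔮
    rw [h𝔮'def, PrimeSpectrum.comap_asIdeal, Ideal.mem_comap] at h
    change invol 2 (PowerSeries.C (2 : ℤ_[2])) ∈ 𝔮.asIdeal at h
    rwa [invol_C] at h
  have hp𝔮'' : PowerSeries.C ((2 : ℕ) : ℤ_[2]) ∉ 𝔮'.asIdeal := by exact_mod_cast hp𝔮'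
  have hsymι : lengthAt (IwasawaAlgebra 2) Dι.X 𝔮' =
      lengthAt (IwasawaAlgebra 2) Dι.X (PrimeSpectrum.comap (invol 2).toRingHom 𝔮') :=
    selmerDualContra_lengthAt_symm_of_lengthAt_symm D Dι 𝔮' (hsymD 𝔮' h𝔮' hp𝔮'')
  -- the key-`γ⁻¹` length-form door at `ι𝔮`, every generator
  have hA := lengthAt_selmerDualContra_le_of_splitTwistDescent_negTwo_of_lengthAt_symm_fe hDesc h12 W f κ γ hsp hκ hγ hγ'
    hf Dι Lt m hLt hLt0 𝔮' h𝔮' hp𝔮' hsymι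
  -- transport back to key `γ` at `𝔮`
  rw [Kato2004.selmerDualData_lengthAt_eq_inv D Dι 𝔮,
    Kato2004.lengthAt_quotient_span_eq_comap_invol_of_map_invol_span_eq hLtι 𝔮]
  exact hA

/-- **Member decomposition door, (−2)-block, key `γ`, EVERY generator, keyed by the (−1) Literature fact** — for ANY `W₁ ∼_ℚ W`
(Kato's member of the reducible (−2)-split-twist block included), by the pseudo-isogeny transport
`lengthAt_selmerDual_eq_of_isIsogenous`. [cite: Kato2004Asterisque, §8.3 (p. 181), Thm. 12.5 (3) and (12.5.1) (p. 222), §17.13 (pp. 279–280)]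
[cite: GreenbergLNM1716, Thm. 1.14 (p. 68), §4 (p. 107)] [cite: GreenbergVatsal2000, §2 (p. 28)] [cite: MazurTateTeitelbaum1986Invent, §I.17] -/
theorem lengthAt_selmerDual_le_of_splitTwistDescent_negTwo_of_decomposition_fe_of_isIsogenous
    (hDesc : Kato2004.exists_splitTwistDivisibilityInputsDescent_negOne_two) (h12 : Kato2004.thm12_4)
    (h114 : Greenberg1999_thm114_charIdeal_iota_invariant)
    (h114F : Greenberg1999.thm114_charIdeal_iota_invariant_splitMult_baseChange)
    (W : WeierstrassCurve ℚ) [W.IsElliptic] [W.IsGloballyMinimal] [ContinuousSMul ℤ_[2] (W.tateModule 2)]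
    {N : ℕ} [NeZero N] (f : CuspForm (Gamma0 N) 2) (κ : ZpExtension ℚ 2) (γ : absoluteGaloisGroup ℚ)
    (hsp : (W.quadraticTwist (-2)).HasSplitMultiplicativeReductionAtPrime 2)
    (hκ : κ.IsCyclotomic) (hγ : κ.IsTopGenerator γ) (hγ' : IsCyclotomicVariable 2 γ)
    (hf : IsNewformOf (W.quadraticTwist (-2)) f) (D : W.SelmerDualData κ γ)
    (W' : WeierstrassCurve ℚ) [W'.IsElliptic] [W'.IsGloballyMinimal] (hmult' : W'.HasMultiplicativeReductionAtPrime 2)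
    (F : Type) [Field F] [NumberField F]
    (hF : ∀ v : HeightOneSpectrum (𝓞 F), (2 : 𝓞 F) ∈ v.asIdeal → (W'.baseChange F).HasSplitMultiplicativeReductionAt v)
    (κF : ZpExtension F 2) (γF : Field.absoluteGaloisGroup F) (hκF : κF.IsCyclotomic) (hγF : κF.IsTopGenerator γF)
    (DF : (W'.baseChange F).SelmerDualData κF γF) [Module.Finite (IwasawaAlgebra 2) DF.X] (hDF : DF.IsTorsion)
    (D' : W'.SelmerDualData κ γ) [Module.Finite (IwasawaAlgebra 2) D'.X] (hD' : D'.IsTorsion)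
    (hdec : ∀ 𝔮 : PrimeSpectrum (IwasawaAlgebra 2), 𝔮.asIdeal.height = 1 →
      PowerSeries.C (2 : ℤ_[2]) ∉ 𝔮.asIdeal →
      lengthAt (IwasawaAlgebra 2) DF.X 𝔮 = lengthAt (IwasawaAlgebra 2) D'.X 𝔮 + lengthAt (IwasawaAlgebra 2) D.X 𝔮)
    (Lt : IwasawaAlgebra 2) (m : ℕ)
    (hLt : iwasawaToPowerSeries 2 Lt =
      PowerSeries.C ((2 : ℚ_[2]) ^ m) * padicLFunctionMinusBranchMultTwist f (1 : ℚ_[2]) 1 (-1))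
    (hLt0 : Lt ≠ 0)
    (W₁ : WeierstrassCurve ℚ) [W₁.IsElliptic] (hiso : IsIsogenous W W₁) (D₁ : W₁.SelmerDualData κ γ)
    (𝔮 : PrimeSpectrum (IwasawaAlgebra 2)) (h𝔮 : 𝔮.asIdeal.height = 1)
    (hp𝔮 : PowerSeries.C (2 : ℤ_[2]) ∉ 𝔮.asIdeal) :
    lengthAt (IwasawaAlgebra 2) D₁.X 𝔮 ≤
      lengthAt (IwasawaAlgebra 2) (IwasawaAlgebra 2 ⧸ Ideal.span {Lt}) 𝔮 := by
  have hp𝔮' : PowerSeries.C ((2 : ℕ) : ℤ_[2]) ∉ 𝔮.asIdeal := by exact_mod_cast hp𝔮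
  rw [← lengthAt_selmerDual_eq_of_isIsogenous hiso D D₁ 𝔮 hp𝔮']
  exact lengthAt_selmerDual_le_of_splitTwistDescent_negTwo_of_decomposition_fe hDesc h12 h114 h114F W f κ γ hsp hκ hγ hγ'
    hf D W' hmult' F hF κF γF hκF hγF DF hDF D' hD' hdec Lt m hLt hLt0 𝔮 h𝔮 hp𝔮

/-! ## §2 The model doors over `ℚ(√−2)` (model given) -/

section Model

variable (W : WeierstrassCurve ℚ) [W.IsElliptic] [W.IsGloballyMinimal] [ContinuousSMul ℤ_[2] (W.tateModule 2)]
  (W' : WeierstrassCurve ℚ) [W'.IsElliptic] [W'.IsGloballyMinimal] {V : VariableChange ℚ} (hV : V • W = W'.quadraticTwist (-2))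
  {θ : AlgebraicClosure ℚ} (hθ : θ ^ 2 = algebraMap ℚ (AlgebraicClosure ℚ) (-2))
  {N : ℕ} [NeZero N] (f : CuspForm (Gamma0 N) 2) (κ : ZpExtension ℚ 2) (γ : absoluteGaloisGroup ℚ)
  (hsp : (W.quadraticTwist (-2)).HasSplitMultiplicativeReductionAtPrime 2)
  (hκ : κ.IsCyclotomic) (hγ : κ.IsTopGenerator γ) (hγ' : IsCyclotomicVariable 2 γ) (hγθ : γ • θ = θ)
  (hf : IsNewformOf (W.quadraticTwist (-2)) f)
  -- the model of `Sel(W′/ℚ_∞(θ))` over a number field `F` (intended `ℚ(√−2)`) where `W′` is split multiplicative above `2`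
  (F : Type) [Field F] [NumberField F]
  (hF : ∀ v : HeightOneSpectrum (𝓞 F), (2 : 𝓞 F) ∈ v.asIdeal → (W'.baseChange F).HasSplitMultiplicativeReductionAt v)
  (κF : ZpExtension F 2) (γF : absoluteGaloisGroup F) (hκF : κF.IsCyclotomic) (hγF : κF.IsTopGenerator γF)
  (DF : (W'.baseChange F).SelmerDualData κF γF) [(kerStab κ θ).Normal]
  (ΘS : (W'.baseChange F).selmerInfty κF ≃+ W'.selmerGroupOver 2 (kerStab κ θ))
  (hΘS : ∀ s, ((ΘS ((W'.baseChange F).conjSelmerInfty κF γF s) : W'.selmerGroupOver 2 (kerStab κ θ)) :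
      W'.subgroupH1 2 (kerStab κ θ)) = W'.conjH1 2 (kerStab κ θ) γ (ΘS s : W'.selmerGroupOver 2 (kerStab κ θ)))
  -- the `2`-adic `L`-function side: an integral multiple `L̃ = 2^m·L⁻₂ ≠ 0` of the `ω·χ₂`-branch
  (Lt : IwasawaAlgebra 2) (m : ℕ)
  (hLt : iwasawaToPowerSeries 2 Lt =
    PowerSeries.C ((2 : ℚ_[2]) ^ m) * padicLFunctionMinusBranchMultTwist f (1 : ℚ_[2]) 1 (-1))
  (hLt0 : Lt ≠ 0)

include hV hθ hsp hκ hγ hγ' hγθ hf hF hκF hγF DF hΘS hLt hLt0 in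
/-- **(−2)-BLOCK DOOR, key `γ`, EVERY generator fixing `√−2`, keyed by the (−1) Literature fact, modulo the model over `ℚ(√−2)`**:
`ℓ_𝔮(X(W/ℚ_∞)) ≤ ℓ_𝔮(Λ/(L̃))` at every height-one `𝔮 ∌ 2` for every key-`γ` datum `D` of the ADDITIVE `W` (`W^{(−2)}` split
multiplicative at `2`; `W′` a globally minimal model of the twist by `−2`), from `Kato2004.thm12_4`, Greenberg's Thm. 1.14 ×2 and
Thm. 1.5 (PRINT, BY NAME), the (−1) Literature fact through R15, the model identification `ΘS` over `F ∋ √−2`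
(`AddKatoTwoQuadLayer.hdec_of_model_negTwo`, `isTorsion_model_negTwo`), and `L̃ = 2^m·L⁻₂ ≠ 0`. The body of
`lengthAt_selmerDual_le_of_oddBranchInputsPrintExactAnyImage_negTwo_fe_of_model` with the torsion of `X(W/ℚ_∞)` from
`isTorsion_selmerDual_of_splitTwistDescent_negTwo_of_doorMultiple` and the Decomposition door of §1.
[cite: Kato2004Asterisque, Thm. 12.4 (p. 221), Thm. 12.5 (3) and (12.5.1) (p. 222), Thm. 17.4 (1) (p. 273), §17.13 (pp. 279–280)]
[cite: GreenbergLNM1716, Thm. 1.5 (p. 61), Thm. 1.14 (p. 68), §4 (p. 107)] [cite: MazurTateTeitelbaum1986Invent, §I.13, §I.17] -/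
theorem lengthAt_selmerDual_le_of_splitTwistDescent_negTwo_fe_of_model
    (hDesc : Kato2004.exists_splitTwistDivisibilityInputsDescent_negOne_two) (h12 : Kato2004.thm12_4)
    (h114 : Greenberg1999_thm114_charIdeal_iota_invariant)
    (h114F : Greenberg1999.thm114_charIdeal_iota_invariant_splitMult_baseChange) (h15 : thm15_isTorsion_multiplicative_rat) :
    ∀ (D : W.SelmerDualData κ γ) (𝔮 : PrimeSpectrum (IwasawaAlgebra 2)), 𝔮.asIdeal.height = 1 →
      PowerSeries.C (2 : ℤ_[2]) ∉ 𝔮.asIdeal →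
      lengthAt (IwasawaAlgebra 2) D.X 𝔮 ≤ lengthAt (IwasawaAlgebra 2) (IwasawaAlgebra 2 ⧸ Ideal.span {Lt}) 𝔮 := by
  intro D 𝔮 h𝔮 hp𝔮
  haveI : Fact (Nat.Prime 2) := ⟨Nat.prime_two⟩
  -- the twist side: a key-`γ` datum of `W′`, finitely generated, torsion by Greenberg's Thm. 1.5
  let D₀' : W'.SelmerDualData κ γ := W'.selmerDualData κ hγ
  haveI : Module.Finite (IwasawaAlgebra 2) D₀'.X := D₀'.module_finite_holds hγ
  haveI : Module.Finite (IwasawaAlgebra 2) DF.X := DF.module_finite_holds hγF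
  have hmult' : W'.HasMultiplicativeReductionAtPrime 2 :=
    (hasSplitMultiplicativeReductionAtPrime_twistModel W W' (by norm_num) hV 2 hsp).hasMultiplicativeReductionAtPrime
  have hD₀' : D₀'.IsTorsion :=
    isTorsion_selmerDual_twistModel_of_thm15 h15 W W' hmult' (by norm_num) hV f hf κ γ hκ hγ D₀'
  -- the additive side: torsion from the (−1) Literature fact through R15
  have hD : D.IsTorsion :=
    isTorsion_selmerDual_of_splitTwistDescent_negTwo_of_doorMultiple W f κ γ hsp hκ hγ hγ' hf hDesc D Lt m hLt hLt0
  -- the decomposition through the model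
  have hDF : DF.IsTorsion := AddKatoTwoQuadLayer.isTorsion_model_negTwo κ W' W hV hθ hγθ ΘS hΘS D₀' D DF hD₀' hD
  exact lengthAt_selmerDual_le_of_splitTwistDescent_negTwo_of_decomposition_fe hDesc h12 h114 h114F W f κ γ hsp hκ hγ hγ' hf
    D W' hmult' F hF κF γF hκF hγF DF hDF D₀' hD₀' (AddKatoTwoQuadLayer.hdec_of_model_negTwo κ W' W hV hθ hγθ ΘS hΘS D₀' D DF)
    Lt m hLt hLt0 𝔮 h𝔮 hp𝔮

include hV hθ hsp hκ hγ hγ' hγθ hf hF hκF hγF DF hΘS hLt hLt0 in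
/-- **(−2)-BLOCK DOOR, key `γ⁻¹` (the PRINT-EXACT currency), EVERY generator fixing `√−2`, keyed by the (−1) Literature fact,
modulo the model** — the key-`γ` door at `ι𝔮` for the tree's key-`γ` datum, transported by `Kato2004.selmerDualData_lengthAt_inv_eq`
and the functional equation of the `ω·χ₂`-branch (`MultOddBranchFE.map_invol_span_eq_of_eq_oddBranchMultTwist_two_of_split`).
[cite: Kato2004Asterisque, Thm. 12.5 (3) and (12.5.1) (p. 222), §17.13 (pp. 279–280)] [cite: MazurTateTeitelbaum1986Invent, §I.17]
[cite: Greenberg1989, pp. 101–102 (S^ι)] -/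
theorem lengthAt_selmerDualContra_le_of_splitTwistDescent_negTwo_fe_of_model
    (hDesc : Kato2004.exists_splitTwistDivisibilityInputsDescent_negOne_two) (h12 : Kato2004.thm12_4)
    (h114 : Greenberg1999_thm114_charIdeal_iota_invariant)
    (h114F : Greenberg1999.thm114_charIdeal_iota_invariant_splitMult_baseChange) (h15 : thm15_isTorsion_multiplicative_rat) :
    ∀ (D' : W.SelmerDualData κ γ⁻¹) (𝔮 : PrimeSpectrum (IwasawaAlgebra 2)), 𝔮.asIdeal.height = 1 →
      PowerSeries.C (2 : ℤ_[2]) ∉ 𝔮.asIdeal →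
      lengthAt (IwasawaAlgebra 2) D'.X 𝔮 ≤ lengthAt (IwasawaAlgebra 2) (IwasawaAlgebra 2 ⧸ Ideal.span {Lt}) 𝔮 := by
  intro D' 𝔮 h𝔮 hp𝔮
  haveI : Fact (Nat.Prime 2) := ⟨Nat.prime_two⟩
  set 𝔮' := PrimeSpectrum.comap (invol 2).toRingHom 𝔮 with h𝔮'def
  have h𝔮' : 𝔮'.asIdeal.height = 1 := by rw [h𝔮'def, Kato2004.height_comap_invol]; exact h𝔮
  have hp𝔮' : PowerSeries.C (2 : ℤ_[2]) ∉ 𝔮'.asIdeal := by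
    intro h
    apply hp𝔮
    rw [h𝔮'def, PrimeSpectrum.comap_asIdeal, Ideal.mem_comap] at h
    change invol 2 (PowerSeries.C (2 : ℤ_[2])) ∈ 𝔮.asIdeal at h
    rwa [invol_C] at h
  have hA := lengthAt_selmerDual_le_of_splitTwistDescent_negTwo_fe_of_model W W' hV hθ f κ γ hsp hκ hγ hγ' hγθ hf F hF κF γF
    hκF hγF DF ΘS hΘS Lt m hLt hLt0 hDesc h12 h114 h114F h15 (W.selmerDualData κ hγ) 𝔮' h𝔮' hp𝔮'
  rw [Kato2004.selmerDualData_lengthAt_inv_eq (W.selmerDualData κ hγ) D' 𝔮,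
    Kato2004.lengthAt_quotient_span_eq_comap_invol_of_map_invol_span_eq
      (MultOddBranchFE.map_invol_span_eq_of_eq_oddBranchMultTwist_two_of_split hsp hf hLt) 𝔮]
  exact hA

include hV hθ hsp hκ hγ hγ' hγθ hf hF hκF hγF DF hΘS hLt hLt0 in
/-- **(−2)-BLOCK MEMBER DOOR, EVERY generator fixing `√−2`, keyed by the (−1) Literature fact, modulo the model**:
`ℓ_𝔮(X(W₁/ℚ_∞)) ≤ ℓ_𝔮(Λ/(L̃))` at every height-one `𝔮 ∌ 2` for EVERY `W₁ ∼_ℚ W` and every key-`γ` datum `D₁` of `W₁`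
(`lengthAt_selmerDual_eq_of_isIsogenous`). [cite: Kato2004Asterisque, §8.3 (p. 181), Thm. 12.5 (3) and (12.5.1) (p. 222), §17.13 (pp. 279–280)]
[cite: GreenbergVatsal2000, §2 (p. 28)] [cite: GreenbergLNM1716, Thm. 1.14 (p. 68)] -/
theorem lengthAt_selmerDual_le_of_splitTwistDescent_negTwo_fe_of_model_of_isIsogenous
    (hDesc : Kato2004.exists_splitTwistDivisibilityInputsDescent_negOne_two) (h12 : Kato2004.thm12_4)
    (h114 : Greenberg1999_thm114_charIdeal_iota_invariant)
    (h114F : Greenberg1999.thm114_charIdeal_iota_invariant_splitMult_baseChange) (h15 : thm15_isTorsion_multiplicative_rat)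
    (W₁ : WeierstrassCurve ℚ) [W₁.IsElliptic] (hiso : IsIsogenous W W₁) (D₁ : W₁.SelmerDualData κ γ)
    (𝔮 : PrimeSpectrum (IwasawaAlgebra 2)) (h𝔮 : 𝔮.asIdeal.height = 1) (hp𝔮 : PowerSeries.C (2 : ℤ_[2]) ∉ 𝔮.asIdeal) :
    lengthAt (IwasawaAlgebra 2) D₁.X 𝔮 ≤ lengthAt (IwasawaAlgebra 2) (IwasawaAlgebra 2 ⧸ Ideal.span {Lt}) 𝔮 := by
  haveI : Fact (Nat.Prime 2) := ⟨Nat.prime_two⟩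
  have hp𝔮' : PowerSeries.C ((2 : ℕ) : ℤ_[2]) ∉ 𝔮.asIdeal := by exact_mod_cast hp𝔮
  rw [← lengthAt_selmerDual_eq_of_isIsogenous hiso (W.selmerDualData κ hγ) D₁ 𝔮 hp𝔮']
  exact lengthAt_selmerDual_le_of_splitTwistDescent_negTwo_fe_of_model W W' hV hθ f κ γ hsp hκ hγ hγ' hγθ hf F hF κF γF hκF
    hγF DF ΘS hΘS Lt m hLt hLt0 hDesc h12 h114 h114F h15 (W.selmerDualData κ hγ) 𝔮 h𝔮 hp𝔮

end Model

end Summit.BirchSwinnertonDyer.BirchSwinnertonDyer.Theorems.AddKatoTwo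

end
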